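/-
Copyright (c) 2026 the pub-hodgecm-mathlib formalisation cell (harness21).  Prover seat hodgecm-mathlib-K2Liu-p14 (g2), Track B «K2-LIT»,
#184♮ = hLiu418 = `stmt-HodgeConjecture-24832`; socket #42S organ S2 («ARCH SPAN BY K-TYPE PATHS»), S2-F part 2 (LEAD F0P6-plan (g14) M-158f §4 S2-F, BATCH #7 (e) «k_σ BY VALUE»,
BATCH #11 σ12 «κ = ±3 by name», BATCH #14 (1) «S2-F part 2 by name on ★ S2-B FILE 1»; K2Liu-p11 (g2) ★ `K2LiuArchFrameBridge`; K2Liu-ref1 (g5) 12:16:25Z (4)).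
-/
import Summits.HodgeConjecture.HodgeConjecture.Theorems.K2LiuArchGaussianKType     -- ★ S2-F part 1: `eq_mul_det_zpow_mul_archScalarSection`, `ne_zero_of_apply_one_ne_zero`
import Summits.HodgeConjecture.HodgeConjecture.Theorems.K2LiuArchFrameBridge       -- ★ S2-B FILE 1: the chart `κ(k₁,k₂)`, `exists_kappa_eq_of_stab`, `denom_kappa_I`, `det_kappa`
import HarnessLib

/-!
# Crux `HLiu418`, organ S2, file S2-F (part 2): THE GAUSSIAN ANCHOR IN THE CHART LETTERS `κ(k₁,k₂)` — a Siegel section of `I_w(s, χ_{−(m₁+m₂)})` with the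
# `K_w`-CHARACTER `κ(a,b) ↦ det(a)^{m₁} det(b)^{m₂}` IS `f(1) · det(g)^{m₁} · f⁰_{s, m₁−m₂}(g)`, nowhere zero; the explicit generator has that character

Cell `hodgecm-mathlib`, crux item hLiu418 = `stmt-HodgeConjecture-24832`; squad K2 ∕ K2Liu; prover K2Liu-p14 (g2).  THEOREMS ONLY (no `def`, no instance, no
notation, no named-fact hypothesis, no `sorry`); lane `--supports stmt-HodgeConjecture-24832 --as helper`.  Index-generic `l`.

THE ANCHOR, HYPOTHESIS-FIRST (BATCH #7 (e), #14 (1)).  The arch Siegel–Weil section `f = SW_w(Gauss_σ)` of the Gaussian of `V′_σ ⊗ W` has (F-P) the parabolic law of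
`I_w(½, χ_w³)` (S2-D `archSWImage_le_archDegPS`, K2Liu-p05) and (F-K) the `K_w`-CHARACTER `f(g · κ(a,b)) = det(a)^{m₁} det(b)^{m₂} f(g)` on the chart
`κ(a,b) = T₁·diag(a,b)·½T₁′` of ★ S2-B (`(m₁, m₂) = (κ − l_σ, l_σ)`, `l_σ = (κ+3)∕2 − p′`, κ = ±3 the weight of `χ_w³` — ★ Konno–Konno `weilRepPair_κ_hermitePi_zero`
transported by S2-J, K2Liu-p05).  Given these two inputs BY VALUE this file concludes, in the chart letters S2-K∕S2-P∕S2-asm read: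
* §1 `stabType_of_kappaType_UJ` — the `κ`-character on `U(J)` ⇒ the `Stab(i1)`-type of ★ part 1's `hK` (★ `exists_kappa_eq_of_stab`; the `U(J)`-restricted form of ★ p11
  `stabType_of_kappaType`); **`eq_mul_det_zpow_mul_archScalarSection_of_kappaType`** — `f(g) = f(1)·det(g)^{m₁}·archScalarSection (m₁−m₂) s g` on `U(J)`;
  **`ne_zero_of_kappaType_of_apply_one_ne_zero`** — `f(1) ≠ 0 ⇒ f` nowhere zero on `U(J)`; `compactPicture_eq_of_kappaType` — its compact picture
  `F_f(v) = f(κ(1,v)) = f(1) · det(v)^{m₂}` on unitary `v` (so `F_f` spans the scalar K-type `(det k₁)^{m₁}(det k₂)^{m₂}`, λ = `(m₂, m₂)`-line in S2-K's labels);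
* §2 the explicit generator `h(g) = det(g)^{m₁}·f⁰_{s,m₁−m₂}(g)` HAS the `κ`-character (`det_zpow_mul_archScalarSection_mul_kappa`) — with ★ part 1
  `isArchSiegelSection_det_zpow_mul_archScalarSection` this is the generator of the anchor cell for S2-C.
BY VALUE (κ = −3, ref1 12:16:25Z (4), p11 (B5)): `σ = (2,1)`: `(m₁,m₂) = (−1,−2)`, `f = c·det(g)^{−1}·f⁰_{½,1}`; `σ = (1,2)`: `(−2,−1)`, `f = c·det(g)^{−2}·f⁰_{½,−1}`;
`σ = (3,0)`: `(0,−3)`, `f = c·f⁰_{½,3}` (the holomorphic weight-3 vector); `σ = (0,3)`: `(−3,0)`, `f = c·det(g)^{−3}·f⁰_{½,−3}`; `c = f(1) = Gauss(0)·(vacuum pairing) ≠ 0` (S2-J).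
References: [Shimura1997, §16.4]; [KonnoKonno2007, Lemma 5.2]; [LeeZhu1998, §5 (5.3)]; [Folland1989, (4.39)].
HONEST LABEL.  Count-neutral helper: `HC_CM` is proved only modulo the 7 printed citations (2 remaining named inputs: hLiu418 = `stmt-HodgeConjecture-24832`,
h413 = `stmt-HodgeConjecture-24833`) until rung 0 closes.
-/

set_option autoImplicit false
set_option linter.dupNamespace false -- the mandated namespace repeats `HodgeConjecture.HodgeConjecture`

noncomputable section

open Complex Matrix
open scoped ComplexOrder ComplexConjugate

namespace Summit.HodgeConjecture.HodgeConjecture.Cruxes.HLiu418.K2LiuArchGaussianKTypeFrame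

open Literature.NumberTheory.ModularForms.SiegelUpperHalfSpace (num denom moeb num_def denom_def moeb_def)
open Summit.HodgeConjecture.HodgeConjecture.Cruxes.HLiu418.K2LiuHermitianTubeCocycle
open Summit.HodgeConjecture.HodgeConjecture.Cruxes.HLiu418.K2LiuArchInducedTubeDefs
open Summit.HodgeConjecture.HodgeConjecture.Cruxes.HLiu418.K2LiuArchInducedTubeSection
open Summit.HodgeConjecture.HodgeConjecture.Cruxes.HLiu418.K2LiuArchGaussianKType
open Summit.HodgeConjecture.HodgeConjecture.Cruxes.HLiu418.K2LiuArchFrameBridge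

variable {l : Type*} [Fintype l] [DecidableEq l]

/-! ## §1 From the `κ`-character to the anchor -/

/-- **THE `κ`-CHARACTER ON `U(J)` IS THE `Stab(i1)`-TYPE OF ★ part 1** (the `U(J)`-restricted form of ★ `stabType_of_kappaType`; ★ `exists_kappa_eq_of_stab`).
[cite: Shimura1997, §6.5] -/
theorem stabType_of_kappaType_UJ {f : Matrix (l ⊕ l) (l ⊕ l) ℂ → ℂ} {m₁ m₂ : ℤ}
    (hκ : ∀ (g : Matrix (l ⊕ l) (l ⊕ l) ℂ) (a b : Matrix l l ℂ), gᴴ * Matrix.J l ℂ * g = Matrix.J l ℂ → aᴴ * a = 1 → bᴴ * b = 1 →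
      f (g * ((fromBlocks 1 1 (I • 1) (-(I • 1)) : Matrix (l ⊕ l) (l ⊕ l) ℂ) * fromBlocks a 0 0 b * ((2 : ℂ)⁻¹ • fromBlocks 1 (-(I • 1)) 1 (I • 1)))) =
        a.det ^ m₁ * b.det ^ m₂ * f g) :
    ∀ g u : Matrix (l ⊕ l) (l ⊕ l) ℂ, gᴴ * Matrix.J l ℂ * g = Matrix.J l ℂ → uᴴ * Matrix.J l ℂ * u = Matrix.J l ℂ → moeb u (I • (1 : Matrix l l ℂ)) = I • 1 →
      f (g * u) = (u.toBlocks₁₁ + I • u.toBlocks₁₂).det ^ m₁ * (u.toBlocks₁₁ - I • u.toBlocks₁₂).det ^ m₂ * f g := by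
  intro g u hg hu hI
  obtain ⟨h₁, h₂, hu_eq⟩ := exists_kappa_eq_of_stab hu hI
  conv_lhs => rw [hu_eq]
  exact hκ g _ _ hg h₁ h₂

/-- **THE GAUSSIAN ANCHOR IN THE CHART LETTERS**: a Siegel section of `I_w(s, χ_{−(m₁+m₂)})` with the `K_w`-character `κ(a,b) ↦ det(a)^{m₁} det(b)^{m₂}` on `U(J)` IS
`f(1) · det(g)^{m₁} · archScalarSection (m₁ − m₂) s g` on `U(J)` (★ part 1 `eq_mul_det_zpow_mul_archScalarSection`). [cite: Shimura1997, §16.4] [cite: KonnoKonno2007, Lemma 5.2] -/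
theorem eq_mul_det_zpow_mul_archScalarSection_of_kappaType (m₁ m₂ : ℤ) (s : ℂ) {f : Matrix (l ⊕ l) (l ⊕ l) ℂ → ℂ}
    (hP : IsArchSiegelSection (fun z : ℂ => (conj z / ((‖z‖ : ℝ) : ℂ)) ^ (-(m₁ + m₂))) s f)
    (hκ : ∀ (g : Matrix (l ⊕ l) (l ⊕ l) ℂ) (a b : Matrix l l ℂ), gᴴ * Matrix.J l ℂ * g = Matrix.J l ℂ → aᴴ * a = 1 → bᴴ * b = 1 →
      f (g * ((fromBlocks 1 1 (I • 1) (-(I • 1)) : Matrix (l ⊕ l) (l ⊕ l) ℂ) * fromBlocks a 0 0 b * ((2 : ℂ)⁻¹ • fromBlocks 1 (-(I • 1)) 1 (I • 1)))) =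
        a.det ^ m₁ * b.det ^ m₂ * f g)
    {g : Matrix (l ⊕ l) (l ⊕ l) ℂ} (hg : gᴴ * Matrix.J l ℂ * g = Matrix.J l ℂ) :
    f g = f 1 * g.det ^ m₁ * archScalarSection (m₁ - m₂) s g :=
  eq_mul_det_zpow_mul_archScalarSection m₁ m₂ s hP (stabType_of_kappaType_UJ hκ) hg

/-- **`f(1) ≠ 0 ⇒ f` NOWHERE ZERO ON `U(J)`** for such `f` (the anchor generates everywhere; `c_σ = SW(Gauss_σ)(1) ≠ 0` suffices). [cite: Shimura1997, §16.4] -/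
theorem ne_zero_of_kappaType_of_apply_one_ne_zero (m₁ m₂ : ℤ) (s : ℂ) {f : Matrix (l ⊕ l) (l ⊕ l) ℂ → ℂ}
    (hP : IsArchSiegelSection (fun z : ℂ => (conj z / ((‖z‖ : ℝ) : ℂ)) ^ (-(m₁ + m₂))) s f)
    (hκ : ∀ (g : Matrix (l ⊕ l) (l ⊕ l) ℂ) (a b : Matrix l l ℂ), gᴴ * Matrix.J l ℂ * g = Matrix.J l ℂ → aᴴ * a = 1 → bᴴ * b = 1 →
      f (g * ((fromBlocks 1 1 (I • 1) (-(I • 1)) : Matrix (l ⊕ l) (l ⊕ l) ℂ) * fromBlocks a 0 0 b * ((2 : ℂ)⁻¹ • fromBlocks 1 (-(I • 1)) 1 (I • 1)))) =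
        a.det ^ m₁ * b.det ^ m₂ * f g)
    (h1 : f 1 ≠ 0) {g : Matrix (l ⊕ l) (l ⊕ l) ℂ} (hg : gᴴ * Matrix.J l ℂ * g = Matrix.J l ℂ) : f g ≠ 0 :=
  ne_zero_of_apply_one_ne_zero m₁ m₂ s hP (stabType_of_kappaType_UJ hκ) h1 hg

/-- **THE COMPACT PICTURE OF THE ANCHOR**: `F_f(v) := f(κ(1,v)) = f(1) · det(v)^{m₂}` for unitary `v` — the one-dimensional K-type `(a,b) ↦ det(a)^{m₁}det(b)^{m₂}` read on
`U(l)` (the `χ(det a)` of ★ `apply_kappa` absorbs `m₁`). [cite: LeeZhu1998, §5 (5.3)] [cite: Knapp1986, VII §1] -/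
theorem compactPicture_eq_of_kappaType {f : Matrix (l ⊕ l) (l ⊕ l) ℂ → ℂ} {m₁ m₂ : ℤ}
    (hκ : ∀ (g : Matrix (l ⊕ l) (l ⊕ l) ℂ) (a b : Matrix l l ℂ), gᴴ * Matrix.J l ℂ * g = Matrix.J l ℂ → aᴴ * a = 1 → bᴴ * b = 1 →
      f (g * ((fromBlocks 1 1 (I • 1) (-(I • 1)) : Matrix (l ⊕ l) (l ⊕ l) ℂ) * fromBlocks a 0 0 b * ((2 : ℂ)⁻¹ • fromBlocks 1 (-(I • 1)) 1 (I • 1)))) =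
        a.det ^ m₁ * b.det ^ m₂ * f g)
    {v : Matrix l l ℂ} (hv : vᴴ * v = 1) :
    f ((fromBlocks 1 1 (I • 1) (-(I • 1)) : Matrix (l ⊕ l) (l ⊕ l) ℂ) * fromBlocks 1 0 0 v * ((2 : ℂ)⁻¹ • fromBlocks 1 (-(I • 1)) 1 (I • 1))) = f 1 * v.det ^ m₂ := by
  have h := hκ 1 1 v J_mem_one (by rw [conjTranspose_one, Matrix.one_mul]) hv
  rw [Matrix.one_mul, Matrix.det_one, _root_.one_zpow, one_mul] at h
  rw [h, mul_comm]
where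
  /-- `1 ∈ U(J)`. -/
  J_mem_one : (1 : Matrix (l ⊕ l) (l ⊕ l) ℂ)ᴴ * Matrix.J l ℂ * 1 = Matrix.J l ℂ := by rw [conjTranspose_one, Matrix.one_mul, Matrix.mul_one]

/-! ## §2 The explicit generator has the `κ`-character -/

/-- **`h(g) := det(g)^{m₁} · f⁰_{s,m₁−m₂}(g)` HAS THE `κ`-CHARACTER** `h(g·κ(a,b)) = det(a)^{m₁} det(b)^{m₂} h(g)` for `g ∈ U(J)`, unitary `a, b`
(★ part 1 `det_zpow_mul_archScalarSection_mul_stab` on the chart: `κ(a,b) ∈ Stab(i1)` with Cayley components `(a,b)`, ★ `kappaFst∕kappaSnd`). [cite: Shimura1997, §16.4] -/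
theorem det_zpow_mul_archScalarSection_mul_kappa (m₁ m₂ : ℤ) (s : ℂ) {g : Matrix (l ⊕ l) (l ⊕ l) ℂ} (hg : gᴴ * Matrix.J l ℂ * g = Matrix.J l ℂ)
    {a b : Matrix l l ℂ} (ha : aᴴ * a = 1) (hb : bᴴ * b = 1) :
    (g * ((fromBlocks 1 1 (I • 1) (-(I • 1)) : Matrix (l ⊕ l) (l ⊕ l) ℂ) * fromBlocks a 0 0 b * ((2 : ℂ)⁻¹ • fromBlocks 1 (-(I • 1)) 1 (I • 1)))).det ^ m₁ *
        archScalarSection (m₁ - m₂) s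
          (g * ((fromBlocks 1 1 (I • 1) (-(I • 1)) : Matrix (l ⊕ l) (l ⊕ l) ℂ) * fromBlocks a 0 0 b * ((2 : ℂ)⁻¹ • fromBlocks 1 (-(I • 1)) 1 (I • 1)))) =
      a.det ^ m₁ * b.det ^ m₂ * (g.det ^ m₁ * archScalarSection (m₁ - m₂) s g) := by
  rw [det_zpow_mul_archScalarSection_mul_stab m₁ m₂ s hg (kappa_mem_UJ ha hb) (moeb_kappa ha hb), kappaFst, kappaSnd]

end Summit.HodgeConjecture.HodgeConjecture.Cruxes.HLiu418.K2LiuArchGaussianKTypeFrame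

end
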